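import Literature.NumberTheory.ModularForms.SiegelHeckeOperatorsModularForms
import Literature.NumberTheory.ModularForms.HeckeOperatorsLevelOne
import HarnessLib

/-!
# The Hecke operator `T(p) = (Γ¹ (1 0; 0 p) Γ¹)` in degree one: `(F|T(p))((τ)) = F((pτ)) + p^{−k}Σ_{b mod p} F(((τ + b)/p))`,
# and `T(p)` of the Siegel modular group `Γ¹ = Sp₂(ℤ)` IS Eie's level-one `T(p)` up to the factor `p^{k−1}`
# (Andrianov–Zhuravlev Ch. 3 §3.2 (3.12), LEMMA 3.4∕(3.39) in degree one; Ch. 4 §1.1 (1.6); Eie §3.3)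

Layer `Literature/NumberTheory/ModularForms`, namespace `Literature.NumberTheory.ModularForms.SiegelHecke` (lane `lit-hodgefound`, Layer A2,
seat `lit-hodgefound-skel-2`, row A2-327; PROGRAMME-A2 item (120), file 3; sequel of A2-325 `SiegelHeckeOperators` (`posSimilitudeGroup`,
`ratMat`, `cmat`, `gammaHom`, `levelPos`, `slashOn`, `heckeT`, LEMMA 1.1 `heckeT_apply_eq_sum`) and A2-326 `SiegelHeckeOperatorsModularForms`
(`blockOfFinTwo`, `siegelSlash_triangular_apply`), on the tree's `HeckeCosetRepresentatives` (`heckeReps`, `repMatrix`,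
`exists_mul_eq_repMatrix`, `eq_of_mul_repMatrix_eq` — the Hermite representatives `(a b; 0 d)` of `SL₂(ℤ)\{det = p}`) and
`HeckeOperatorsLevelOne` (Eie's `T(n)` on Mathlib's `ModularForm 𝒮ℒ k`, `heckeT_apply`), p16's degree-one dictionary (`one1`, `spOfSL`,
`symplecticGroupFinOneEquiv`, `ofUHPFun`, `isSiegelModularForm_ofUHPFun`)).  Definitions with bodies (`ofFinTwo`, `tElem`, `repElem`) and
theorems; no named fact, no instance, no notation.

Source (held text `book:andrianov2015-modular-forms-hecke-operators`), VERBATIM: Ch. 3 §3.2 [p0134] «(3.12) `T(p) = T^n(p) = (diag(1, …, 1, p, …, p))_Γ`»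
(with `Γ = Γⁿ`; for `n = 1`, `T(p) = (Γ¹ (1 0; 0 p) Γ¹)`); §3.3 LEMMA 3.4∕(3.39) (the left cosets of `Γⁿ` in `ΓⁿMΓⁿ` have representatives
`(A B; 0 D)`), in degree one Ch. 1 §3.2 PROPOSITION 3.7 [p0033] (every integral `M` of determinant `m > 0` is `γ(a b; 0 d)`, `γ ∈ SL₂(ℤ)`,
`ad = m`, `0 ≤ b < d`, uniquely); Ch. 4 §1.1 (1.6) `F|T = Σ_i a_i F|_{k,X} M_i`; Ch. 2 §3.2 (3.14) `(F|_k M)(z) = (cz + d)^{−k}F(M⟨z⟩)` (NO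
power of `det M` — the book's normalisation).  Eie, *Topics in Number Theory* §3.3 (held `book:eie2008-topics-number-theory` p0030):
«`T(n)(f(z)) = n^{k−1} Σ_{ad=n} Σ_{b=0}^{d−1} d^{−k} f((az+b)/d)`».  Hence for a prime `p` and `F ∈ 𝔐_φ(Γ¹)`:
`(F|T(p))((τ)) = Σ_{(a b; 0 d)} d^{−k}F(((aτ + b)/d)) = F((pτ)) + p^{−k}Σ_{b=0}^{p−1}F(((τ + b)/p))`, and A–Z's `T(p)` is `p^{1−k}` times
Eie's `T(p)`.

## What is here (degree `n = 1`, `K = Γ¹`, `p` prime where stated)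

* §1 elements of `S¹` from integral `2 × 2` matrices of positive determinant: `transpose_blockOfFinTwo_mul_J_mul` (`ᵗAJA = det A·J` for every
  `2 × 2` matrix — in degree one every matrix is a similitude), `blockOfFinTwo_eq_reindex`, `det_blockOfFinTwo`, `blockOfFinTwo_injective`,
  `ofFinTwoGSp` + `multiplier_ofFinTwoGSp` (`r(A) = det A`), **`ofFinTwo A hA ∈ S¹`**, `mult_ofFinTwo`, `ratMat_ofFinTwo`, `cmat_ofFinTwo`,
  `ratMat_injective`, `ofFinTwo_mul`, `ofFinTwo_coe_eq_gammaHom` (`SL₂(ℤ) ⊂ S¹` through `Γ¹`), `mem_levelPos_top_iff` (`M ∈ Γ¹ ⊂ S¹ ⟺ M = γ`,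
  `γ ∈ SL₂(ℤ)`).
* §2 **`tElem p`** (`= (1 0; 0 p)`, (3.12) in degree one), `repElem i` (`= (a b; 0 d)`), `cmat_repElem`, `repElem_injOn`,
  `repElem_one_mem` (`(1 b; 0 p) = (1 0; 0 p)·T^b`), `repElem_prime_mem` (`(p 0; 0 1) = S(1 0; 0 p)(−S)`), `mem_heckeReps_prime_iff`,
  **`repElem_mem_doubleCoset`** ∕ **`exists_repElem_cover`** ∕ **`repElem_inj_of_mem`** — the book's three conditions of LEMMA 1.1 for
  `{(a b; 0 d)} = heckeReps p` as representatives of `Γ¹\Γ¹(1 0; 0 p)Γ¹` (via the tree's Hermite normal form).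
* §3 **`heckeT_tElem_apply`**: `(F|T(p))((τ)) = Σ_{(a,b,d) ∈ heckeReps p} d^{−k}F(((aτ + b)/d))` for every `F` with `F|_{𝔥_1} ∈ 𝔐_φ(Γ¹)`;
  `sum_heckeReps_prime` and **`heckeT_tElem_apply_explicit`**: `= F((pτ)) + p^{−k}Σ_{b<p}F(((τ + b)/p))`.
* §4 THE JUNCTION WITH EIE ∕ MATHLIB LEVEL ONE: `restrict_ofUHPFun_mem_fixedPoints` (a level-one `ModularForm 𝒮ℒ k` restricts into
  `𝔐_φ(Γ¹)`), **`heckeT_tElem_ofUHPFun`**: `(ofUHPFun f|T(p))((τ)) = p^{1−k}·(T(p)f)(τ)` with the tree's `Literature.NumberTheory.ModularForms.heckeT`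
  (Eie §3.3) — A–Z's and Eie's operators agree up to the normalising power of `p`.

Not here: composite `m` (A–Z's `T(m)` is the SUM of the double cosets of all integral `M` with `r(M) = m`; for `m = p` there is exactly one),
degree `n ≥ 2` (LEMMA 3.4's block representatives), the `q`-expansion of `F|T(p)` (the tree's `qExpansion_coeff_heckeT` gives it on Eie's side).

## References
* [AndrianovZhuravlev2015] A. N. Andrianov, V. G. Zhuravlev, *Modular Forms and Hecke Operators*, Transl. Math. Monogr. 145, AMS;
  Ch. 3 §3.2 (3.12) (p0134), §3.3 Lemma 3.4 (3.39) (p0138); Ch. 1 §3.2 Proposition 3.7 (p0033); Ch. 4 §1.1 (1.6) (p0237); Ch. 2 §3.2 (3.14) (p0069).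
* [Eie2008] M. Eie, *Topics in Number Theory*, World Scientific (2009), §3.3 (definition of `T(n)`, Remark 3.3.1).
* [DiamondShurman2005] F. Diamond, J. Shurman, *A First Course in Modular Forms*, GTM 228, Prop. 5.2.1 (`T_p = [Γ₁(1 0; 0 p)Γ₁]` and its
  representatives), (5.1).
-/

noncomputable section

open Matrix Complex Set
open scoped MatrixGroups Matrix.Norms.Elementwise

namespace Literature.NumberTheory.ModularForms

namespace SiegelHecke

open Literature.NumberTheory.Automorphic
open Literature.NumberTheory.Automorphic.SymplecticCartan
open Literature.NumberTheory.ModularForms.SiegelUpperHalfSpace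
open Literature.NumberTheory.ModularForms.SiegelModularForm
open UpperHalfPlane hiding I

variable {k : ℤ}

/-! ### §1 Elements of `S¹` from integral `2 × 2` matrices of positive determinant -/

section OfFinTwo

/-- **In degree one every `2 × 2` matrix is a similitude: `ᵗA J A = det A · J`** (block form over `Fin 1 ⊕ Fin 1`).
[cite: AndrianovZhuravlev2015, Ch. 3 §3.1 (3.1) (p0129)] [cite: Klingen1990, §1 (p. 12) («for n = 1, symplecticity just means det m = 1»)] -/
theorem transpose_blockOfFinTwo_mul_J_mul {R : Type*} [CommRing R] (A : Matrix (Fin 2) (Fin 2) R) :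
    (blockOfFinTwo A)ᵀ * Matrix.J (Fin 1) R * blockOfFinTwo A = A.det • Matrix.J (Fin 1) R := by
  ext i j
  rcases i with i | i <;> rcases j with j | j <;> rw [Subsingleton.elim i 0, Subsingleton.elim j 0] <;>
    simp [blockOfFinTwo, Matrix.J, Matrix.mul_apply, Fintype.sum_sum_type, Matrix.fromBlocks, Matrix.det_fin_two] <;> ring

/-- `blockOfFinTwo` is the reindexing `Fin 2 ≃ Fin 1 ⊕ Fin 1`. [cite: Klingen1990, §1 (p. 12)] -/
theorem blockOfFinTwo_eq_reindex {R : Type*} (A : Matrix (Fin 2) (Fin 2) R) :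
    blockOfFinTwo A = Matrix.reindex finSumFinEquiv.symm finSumFinEquiv.symm A := by
  ext i j
  rcases i with i | i <;> rcases j with j | j <;> rw [Subsingleton.elim i 0, Subsingleton.elim j 0] <;> rfl

/-- `det (blockOfFinTwo A) = det A`. [cite: Klingen1990, §1 (p. 12)] -/
theorem det_blockOfFinTwo {R : Type*} [CommRing R] (A : Matrix (Fin 2) (Fin 2) R) : (blockOfFinTwo A).det = A.det := by
  rw [blockOfFinTwo_eq_reindex, Matrix.det_reindex_self]

/-- `blockOfFinTwo` is injective. [cite: Klingen1990, §1 (p. 12)] -/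
theorem blockOfFinTwo_injective {R : Type*} : Function.Injective (blockOfFinTwo (R := R)) := by
  intro A B h
  rw [blockOfFinTwo_eq_reindex, blockOfFinTwo_eq_reindex] at h
  exact (Matrix.reindex _ _).injective h

/-- `det` commutes with the cast `ℤ → ℚ` of the entries. [folklore] -/
private theorem det_map_intCast (A : Matrix (Fin 2) (Fin 2) ℤ) : (A.map ((↑) : ℤ → ℚ)).det = (A.det : ℚ) :=
  (RingHom.map_det (Int.castRingHom ℚ) A).symm

/-- Products commute with the cast `ℤ → ℚ` of the entries. [folklore] -/
private theorem map_intCast_mul' (M N : Matrix (Fin 1 ⊕ Fin 1) (Fin 1 ⊕ Fin 1) ℤ) :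
    (M * N).map ((↑) : ℤ → ℚ) = M.map ((↑) : ℤ → ℚ) * N.map ((↑) : ℤ → ℚ) :=
  Matrix.map_mul (f := Int.castRingHom ℚ)

/-- `ᵗ(A_ℚ) J A_ℚ = det A · J` for the rational matrix of an integral `A`. [cite: AndrianovZhuravlev2015, Ch. 3 §3.1 (3.1) (p0129)] -/
theorem transpose_blockOfFinTwo_map_mul_J_mul (A : Matrix (Fin 2) (Fin 2) ℤ) :
    ((blockOfFinTwo A).map ((↑) : ℤ → ℚ))ᵀ * Matrix.J (Fin 1) ℚ * (blockOfFinTwo A).map ((↑) : ℤ → ℚ) =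
      (A.det : ℚ) • Matrix.J (Fin 1) ℚ := by
  rw [blockOfFinTwo_map, transpose_blockOfFinTwo_mul_J_mul, det_map_intCast]

/-- The rational matrix of an integral `A` with `det A ≠ 0` is invertible. [folklore] -/
private theorem det_blockOfFinTwo_map_ne_zero (A : Matrix (Fin 2) (Fin 2) ℤ) (hA : A.det ≠ 0) :
    ((blockOfFinTwo A).map ((↑) : ℤ → ℚ)).det ≠ 0 := by
  rw [blockOfFinTwo_map, det_blockOfFinTwo, det_map_intCast]
  exact_mod_cast hA

/-- **An integral `2 × 2` matrix `A` with `det A ≠ 0` as an element of `GSp₂(ℚ) = GL₂(ℚ)`** (multiplier `det A`).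
[cite: AndrianovZhuravlev2015, Ch. 3 §3.1 (3.1) (p0129)] [cite: Klingen1990, §1 (p. 12)] -/
def ofFinTwoGSp (A : Matrix (Fin 2) (Fin 2) ℤ) (hA : A.det ≠ 0) : symplecticSimilitudeGroup (Fin 1) ℚ :=
  ⟨Matrix.GeneralLinearGroup.mkOfDetNeZero ((blockOfFinTwo A).map ((↑) : ℤ → ℚ)) (det_blockOfFinTwo_map_ne_zero A hA),
    ⟨(A.det : ℚ), by exact_mod_cast hA, transpose_blockOfFinTwo_map_mul_J_mul A⟩⟩

/-- The matrix of `ofFinTwoGSp A`. [cite: AndrianovZhuravlev2015, Ch. 3 §3.1 (3.1) (p0129)] -/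
theorem coe_ofFinTwoGSp (A : Matrix (Fin 2) (Fin 2) ℤ) (hA : A.det ≠ 0) :
    (((ofFinTwoGSp A hA : symplecticSimilitudeGroup (Fin 1) ℚ) : GL (Fin 1 ⊕ Fin 1) ℚ) : Matrix (Fin 1 ⊕ Fin 1) (Fin 1 ⊕ Fin 1) ℚ) =
      (blockOfFinTwo A).map ((↑) : ℤ → ℚ) := rfl

/-- **`r(A) = det A`** for the similitude of an integral `2 × 2` matrix. [cite: AndrianovZhuravlev2015, Ch. 3 §3.1 (3.1) (p0129)] -/
theorem multiplier_ofFinTwoGSp (A : Matrix (Fin 2) (Fin 2) ℤ) (hA : A.det ≠ 0) :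
    ((multiplier (ofFinTwoGSp A hA) : ℚˣ) : ℚ) = (A.det : ℚ) :=
  multiplier_eq_of_eq (g := ofFinTwoGSp A hA) (transpose_blockOfFinTwo_map_mul_J_mul A)

/-- **The element of `S¹ = GSp₂⁺(ℚ) = GL₂⁺(ℚ)` given by an integral `2 × 2` matrix `A` with `det A > 0`** (multiplier `det A > 0`).
[cite: AndrianovZhuravlev2015, Ch. 3 §3.1 (3.1) (p0129); Ch. 1 §3.2 Proposition 3.7 (p0033)] -/
def ofFinTwo (A : Matrix (Fin 2) (Fin 2) ℤ) (hA : 0 < A.det) : posSimilitudeGroup 1 :=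
  ⟨ofFinTwoGSp A hA.ne', (mem_posSimilitudeGroup_iff _).2 (by
    rw [multiplier_ofFinTwoGSp]
    exact_mod_cast hA)⟩

/-- `r(ofFinTwo A) = det A`. [cite: AndrianovZhuravlev2015, Ch. 3 §3.1 (3.1) (p0129)] -/
theorem mult_ofFinTwo (A : Matrix (Fin 2) (Fin 2) ℤ) (hA : 0 < A.det) : mult (ofFinTwo A hA) = (A.det : ℚ) :=
  multiplier_ofFinTwoGSp A hA.ne'

/-- The rational matrix of `ofFinTwo A`. [cite: AndrianovZhuravlev2015, Ch. 3 §3.1 (3.1) (p0129)] -/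
@[simp] theorem ratMat_ofFinTwo (A : Matrix (Fin 2) (Fin 2) ℤ) (hA : 0 < A.det) :
    ratMat (ofFinTwo A hA) = (blockOfFinTwo A).map ((↑) : ℤ → ℚ) := rfl

/-- The complex matrix of `ofFinTwo A`. [cite: AndrianovZhuravlev2015, Ch. 2 §3.2 (3.14) (p0069)] -/
theorem cmat_ofFinTwo (A : Matrix (Fin 2) (Fin 2) ℤ) (hA : 0 < A.det) :
    cmat (ofFinTwo A hA) = (blockOfFinTwo A).map ((↑) : ℤ → ℂ) := by
  rw [cmat, ratMat_ofFinTwo, Matrix.map_map]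
  exact congrArg _ (funext fun z => Rat.cast_intCast z)

/-- An element of `Sⁿ` is determined by its matrix. [cite: AndrianovZhuravlev2015, Ch. 3 §3.1 (3.1) (p0129)] -/
theorem ratMat_injective {n : ℕ} [NeZero n] : Function.Injective (ratMat (n := n)) := fun _ _ h =>
  Subtype.ext (Subtype.ext (Units.ext h))

/-- `ofFinTwo` is multiplicative. [cite: AndrianovZhuravlev2015, Ch. 3 §3.1 (p0129)] -/
theorem ofFinTwo_mul (A B : Matrix (Fin 2) (Fin 2) ℤ) (hA : 0 < A.det) (hB : 0 < B.det) (hAB : 0 < (A * B).det) :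
    ofFinTwo (A * B) hAB = ofFinTwo A hA * ofFinTwo B hB := by
  apply ratMat_injective
  rw [ratMat_mul, ratMat_ofFinTwo, ratMat_ofFinTwo, ratMat_ofFinTwo, blockOfFinTwo_mul, map_intCast_mul']

/-- The determinant of an element of `SL₂(ℤ)` is positive. [cite: Klingen1990, §1 (p. 12)] -/
theorem det_coe_SL_pos (γ : SL(2, ℤ)) : 0 < (γ : Matrix (Fin 2) (Fin 2) ℤ).det := by
  rw [γ.det_coe]
  exact one_pos

/-- `SL₂(ℤ) ⊂ S¹`: `ofFinTwo γ` is `γ ∈ Γ¹ ⊂ S¹` (through p16's `Sp₂(ℤ) ≃ SL₂(ℤ)`).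
[cite: AndrianovZhuravlev2015, Ch. 3 §3.1 (3.3) (p0129)] [cite: Klingen1990, §1 (p. 12)] -/
theorem ofFinTwo_coe_eq_gammaHom (γ : SL(2, ℤ)) :
    ofFinTwo (γ : Matrix (Fin 2) (Fin 2) ℤ) (det_coe_SL_pos γ) = gammaHom 1 (symplecticGroupFinOneEquiv.symm γ) := by
  apply ratMat_injective
  rw [ratMat_ofFinTwo, ratMat, coe_gammaHom, coe_gammaToGSp, coe_symplecticGroupFinOneEquiv_symm, spOfSL_eq_blockOfFinTwo]

/-- **`M ∈ Γ¹ ⊂ S¹ ⟺ M = γ` for some `γ ∈ SL₂(ℤ)`.** [cite: AndrianovZhuravlev2015, Ch. 3 §3.1 (3.3) (p0129)] -/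
theorem mem_levelPos_top_iff {M : posSimilitudeGroup 1} :
    M ∈ levelPos (⊤ : Subgroup (Matrix.symplecticGroup (Fin 1) ℤ)) ↔
      ∃ γ : SL(2, ℤ), M = ofFinTwo (γ : Matrix (Fin 2) (Fin 2) ℤ) (det_coe_SL_pos γ) := by
  rw [mem_levelPos_iff]
  constructor
  · rintro ⟨γ, -, rfl⟩
    refine ⟨symplecticGroupFinOneEquiv γ, ?_⟩
    rw [ofFinTwo_coe_eq_gammaHom, MulEquiv.symm_apply_apply]
  · rintro ⟨γ, rfl⟩
    exact ⟨symplecticGroupFinOneEquiv.symm γ, Subgroup.mem_top _, (ofFinTwo_coe_eq_gammaHom γ).symm⟩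

end OfFinTwo

/-! ### §2 `T(p) = (Γ¹ (1 0; 0 p) Γ¹)` and its right-coset representatives `(a b; 0 d)` -/

section TElem

/-- **`(1 0; 0 p) ∈ S¹`**, the matrix of `T(p) = (Γ¹ (1 0; 0 p) Γ¹)` ((3.12) in degree one), for any `p ≥ 1`.
[cite: AndrianovZhuravlev2015, Ch. 3 §3.2 (3.12) (p0134)] [cite: DiamondShurman2005, Prop. 5.2.1] -/
def tElem (p : ℕ) (hp : 0 < p) : posSimilitudeGroup 1 :=
  ofFinTwo !![1, 0; 0, (p : ℤ)] (by rw [Matrix.det_fin_two_of]; simpa using hp)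

/-- **The element `(a b; 0 d) ∈ S¹`** of a Hermite representative `i = (a, b, d)` with `ad > 0` (junk `1` otherwise).
[cite: AndrianovZhuravlev2015, Ch. 1 §3.2 Proposition 3.7 (p0033)] [cite: Eie2008, §3.3] -/
def repElem (i : ℤ × ℤ × ℤ) : posSimilitudeGroup 1 :=
  if h : 0 < i.1 * i.2.2 then ofFinTwo (repMatrix i) (by rwa [det_repMatrix]) else 1

/-- For `i ∈ heckeReps p`, `repElem i = ofFinTwo (repMatrix i)`. [cite: Eie2008, §3.3] -/
theorem repElem_eq {p : ℕ} (hp : 0 < p) {i : ℤ × ℤ × ℤ} (hi : i ∈ heckeReps p) :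
    repElem i = ofFinTwo (repMatrix i) (by rw [det_repMatrix_of_mem hp hi]; exact_mod_cast hp) := by
  have h : 0 < i.1 * i.2.2 := by rw [(mem_heckeReps' hp hi).2.2.2.1]; exact_mod_cast hp
  rw [repElem, dif_pos h]

/-- **The complex matrix of `(a b; 0 d)`**: `fromBlocks (a) (b) (0) (d)`. [cite: AndrianovZhuravlev2015, Ch. 2 §3.2 (3.14) (p0069)] -/
theorem cmat_repElem {p : ℕ} (hp : 0 < p) {i : ℤ × ℤ × ℤ} (hi : i ∈ heckeReps p) :
    cmat (repElem i) = Matrix.fromBlocks (one1 (i.1 : ℂ)) (one1 (i.2.1 : ℂ)) (one1 0) (one1 (i.2.2 : ℂ)) := by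
  rw [repElem_eq hp hi, cmat_ofFinTwo, blockOfFinTwo_map]
  simp [blockOfFinTwo, repMatrix]

/-- `repElem` is injective on `heckeReps p`. [cite: Eie2008, §3.3] -/
theorem repElem_injOn {p : ℕ} (hp : 0 < p) : Set.InjOn repElem ↑(heckeReps p) := by
  intro i hi j hj h
  rw [Finset.mem_coe] at hi hj
  rw [repElem_eq hp hi, repElem_eq hp hj] at h
  have h' := congrArg ratMat h
  rw [ratMat_ofFinTwo, ratMat_ofFinTwo] at h'
  have hinj : Function.Injective (fun M : Matrix (Fin 1 ⊕ Fin 1) (Fin 1 ⊕ Fin 1) ℤ => M.map ((↑) : ℤ → ℚ)) :=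
    fun _ _ hM => Matrix.map_injective Int.cast_injective hM
  have h'' := blockOfFinTwo_injective (hinj h')
  obtain ⟨a, b, d⟩ := i
  obtain ⟨a', b', d'⟩ := j
  simp only [repMatrix] at h''
  have h1 := congrFun (congrFun h'' 0) 0
  have h2 := congrFun (congrFun h'' 0) 1
  have h3 := congrFun (congrFun h'' 1) 1
  simp at h1 h2 h3
  rw [h1, h2, h3]

/-- **For a prime `p` the Hermite representatives of determinant `p` are `(1 b; 0 p)`, `0 ≤ b < p`, and `(p 0; 0 1)`.**
[cite: AndrianovZhuravlev2015, Ch. 1 §3.2 Proposition 3.7 (p0033)] [cite: DiamondShurman2005, Prop. 5.2.1 (the representatives `β_j = (1 j; 0 p)`, `β_∞ = (p 0; 0 1)`)] -/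
theorem mem_heckeReps_prime_iff {p : ℕ} (hp : p.Prime) {i : ℤ × ℤ × ℤ} :
    i ∈ heckeReps p ↔ (i.1 = 1 ∧ 0 ≤ i.2.1 ∧ i.2.1 < p ∧ i.2.2 = p) ∨ i = ((p : ℤ), 0, 1) := by
  obtain ⟨a, b, d⟩ := i
  rw [mem_heckeReps hp.pos]
  constructor
  · rintro ⟨ha, hb, hbd, had⟩
    have hd : 0 < d := by nlinarith
    have hdvd : a.toNat ∣ p := ⟨d.toNat, by
      have : ((a.toNat * d.toNat : ℕ) : ℤ) = (p : ℤ) := by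
        push_cast
        rw [Int.toNat_of_nonneg ha.le, Int.toNat_of_nonneg hd.le, had]
      exact_mod_cast this.symm⟩
    rcases (Nat.dvd_prime hp).1 hdvd with h1 | h2
    · left
      have ha1 : a = 1 := by rw [← Int.toNat_of_nonneg ha.le, h1]; rfl
      rw [ha1, one_mul] at had
      exact ⟨ha1, hb, had ▸ hbd, had⟩
    · right
      have hap : a = p := by rw [← Int.toNat_of_nonneg ha.le, h2]
      rw [hap] at had
      have hd1 : d = 1 := by
        have hp0 : (p : ℤ) ≠ 0 := by exact_mod_cast hp.ne_zero
        have := mul_left_cancel₀ hp0 (had.trans (mul_one _).symm)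
        exact this
      rw [hd1] at hbd
      have hb0 : b = 0 := le_antisymm (by omega) hb
      rw [hap, hb0, hd1]
  · rintro (⟨rfl, hb, hbp, rfl⟩ | h)
    · exact ⟨one_pos, hb, hbp, one_mul _⟩
    · simp only [Prod.mk.injEq] at h
      obtain ⟨rfl, rfl, rfl⟩ := h
      exact ⟨by exact_mod_cast hp.pos, le_rfl, one_pos, mul_one _⟩

/-- `γ ↦ γ ∈ Γ¹ ⊂ S¹` on `SL₂(ℤ)`. [cite: AndrianovZhuravlev2015, Ch. 3 §3.1 (3.3) (p0129)] -/
theorem ofFinTwo_coe_mem_levelPos_top (γ : SL(2, ℤ)) :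
    ofFinTwo (γ : Matrix (Fin 2) (Fin 2) ℤ) (det_coe_SL_pos γ) ∈ levelPos (⊤ : Subgroup (Matrix.symplecticGroup (Fin 1) ℤ)) :=
  mem_levelPos_top_iff.2 ⟨γ, rfl⟩

/-- **`(1 b; 0 p) = (1 0; 0 p)·(1 b; 0 1) ∈ Γ¹(1 0; 0 p)Γ¹`.** [cite: DiamondShurman2005, Prop. 5.2.1 (proof)] [cite: AndrianovZhuravlev2015, Ch. 3 §3.3 (3.39) (p0138)] -/
theorem repElem_one_eq {p : ℕ} (hp : 0 < p) (b : ℤ) :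
    repElem (1, b, (p : ℤ)) = tElem p hp *
      ofFinTwo ((ModularGroup.T ^ b : SL(2, ℤ)) : Matrix (Fin 2) (Fin 2) ℤ) (det_coe_SL_pos _) := by
  have h : 0 < (1 : ℤ) * (p : ℤ) := by simpa using hp
  rw [repElem, dif_pos h]
  apply ratMat_injective
  rw [ratMat_mul, ratMat_ofFinTwo, tElem, ratMat_ofFinTwo, ratMat_ofFinTwo, ModularGroup.coe_T_zpow, ← map_intCast_mul',
    ← blockOfFinTwo_mul]
  congr 2
  simp [repMatrix]

/-- **`(p 0; 0 1) = S(1 0; 0 p)(−S) ∈ Γ¹(1 0; 0 p)Γ¹`** (`S = (0 −1; 1 0)`). [cite: DiamondShurman2005, Prop. 5.2.1 (proof)] [cite: AndrianovZhuravlev2015, Ch. 3 §3.3 (3.39) (p0138)] -/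
theorem repElem_prime_eq {p : ℕ} (hp : 0 < p) :
    repElem ((p : ℤ), 0, 1) = ofFinTwo ((ModularGroup.S : SL(2, ℤ)) : Matrix (Fin 2) (Fin 2) ℤ) (det_coe_SL_pos _) * tElem p hp *
      ofFinTwo ((-ModularGroup.S : SL(2, ℤ)) : Matrix (Fin 2) (Fin 2) ℤ) (det_coe_SL_pos _) := by
  have h : 0 < (p : ℤ) * 1 := by simpa using hp
  rw [repElem, dif_pos h]
  apply ratMat_injective
  rw [ratMat_mul, ratMat_mul, ratMat_ofFinTwo, tElem, ratMat_ofFinTwo, ratMat_ofFinTwo, ratMat_ofFinTwo,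
    Matrix.SpecialLinearGroup.coe_neg, ModularGroup.coe_S, ← map_intCast_mul', ← map_intCast_mul', ← blockOfFinTwo_mul,
    ← blockOfFinTwo_mul]
  congr 2
  simp [repMatrix]

variable {p : ℕ}

/-- **(LEMMA 1.1, condition 1) every representative lies in the double coset: `(a b; 0 d) ∈ Γ¹(1 0; 0 p)Γ¹`** for `p` prime.
[cite: AndrianovZhuravlev2015, Ch. 3 §3.3 Lemma 3.4 (3.39) (p0138); Ch. 1 §3.2 Proposition 3.7 (p0033)] [cite: DiamondShurman2005, Prop. 5.2.1] -/
theorem repElem_mem_doubleCoset (hp : p.Prime) {i : ℤ × ℤ × ℤ} (hi : i ∈ heckeReps p) :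
    ∃ γ₁ ∈ levelPos (⊤ : Subgroup (Matrix.symplecticGroup (Fin 1) ℤ)), ∃ γ₂ ∈ levelPos (⊤ : Subgroup (Matrix.symplecticGroup (Fin 1) ℤ)),
      repElem i = γ₁ * tElem p hp.pos * γ₂ := by
  rcases (mem_heckeReps_prime_iff hp).1 hi with ⟨h1, -, -, h4⟩ | h
  · obtain ⟨a, b, d⟩ := i
    simp only at h1 h4
    subst h1 h4
    exact ⟨1, (levelPos ⊤).one_mem, _, ofFinTwo_coe_mem_levelPos_top (ModularGroup.T ^ b), by rw [one_mul, repElem_one_eq]⟩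
  · rw [h, repElem_prime_eq hp.pos]
    exact ⟨_, ofFinTwo_coe_mem_levelPos_top ModularGroup.S, _, ofFinTwo_coe_mem_levelPos_top (-ModularGroup.S), rfl⟩

/-- **(LEMMA 1.1, condition 2) the representatives exhaust `Γ¹(1 0; 0 p)Γ¹`**: for every `γ ∈ Γ¹` some `(a b; 0 d)` lies in the right
coset `Γ¹ (1 0; 0 p)γ` — the tree's Hermite normal form of the integral matrix `(1 0; 0 p)γ` of determinant `p`.
[cite: AndrianovZhuravlev2015, Ch. 1 §3.2 Proposition 3.7 (p0033)] [cite: Eie2008, §3.3 Remark 3.3.1] -/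
theorem exists_repElem_cover (hp : 0 < p) {γ : posSimilitudeGroup 1}
    (hγ : γ ∈ levelPos (⊤ : Subgroup (Matrix.symplecticGroup (Fin 1) ℤ))) :
    ∃ M ∈ (heckeReps p).image repElem, tElem p hp * γ * M⁻¹ ∈ levelPos (⊤ : Subgroup (Matrix.symplecticGroup (Fin 1) ℤ)) := by
  obtain ⟨γ₀, rfl⟩ := mem_levelPos_top_iff.1 hγ
  set N : Matrix (Fin 2) (Fin 2) ℤ := !![1, 0; 0, (p : ℤ)] * (γ₀ : Matrix (Fin 2) (Fin 2) ℤ) with hN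
  have hNdet : N.det = p := by rw [hN, Matrix.det_mul, γ₀.det_coe, mul_one, Matrix.det_fin_two_of]; ring
  obtain ⟨W, i, hi, hW⟩ := exists_mul_eq_repMatrix hp N hNdet
  refine ⟨repElem i, Finset.mem_image_of_mem _ hi, ?_⟩
  have hNpos : 0 < N.det := by rw [hNdet]; exact_mod_cast hp
  have hprod : tElem p hp * ofFinTwo (γ₀ : Matrix (Fin 2) (Fin 2) ℤ) (det_coe_SL_pos γ₀) = ofFinTwo N hNpos := by
    rw [tElem, ← ofFinTwo_mul]
  -- `N = W⁻¹ (a b; 0 d)`, so `(1 0; 0 p)γ (a b; 0 d)⁻¹ = W⁻¹ ∈ Γ¹`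
  have hN' : N = ((W⁻¹ : SL(2, ℤ)) : Matrix (Fin 2) (Fin 2) ℤ) * repMatrix i := by
    rw [← hW, ← Matrix.mul_assoc, ← Matrix.SpecialLinearGroup.coe_mul, inv_mul_cancel, Matrix.SpecialLinearGroup.coe_one,
      Matrix.one_mul]
  have hN2 : ofFinTwo N hNpos = ofFinTwo ((W⁻¹ : SL(2, ℤ)) : Matrix (Fin 2) (Fin 2) ℤ) (det_coe_SL_pos _) * repElem i := by
    apply ratMat_injective
    rw [ratMat_mul, ratMat_ofFinTwo, ratMat_ofFinTwo, repElem_eq hp hi, ratMat_ofFinTwo, ← map_intCast_mul', ← blockOfFinTwo_mul,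
      ← hN']
  rw [hprod, hN2, mul_inv_cancel_right]
  exact ofFinTwo_coe_mem_levelPos_top _

/-- **(LEMMA 1.1, condition 3) distinct representatives lie in distinct right cosets**: `(a b; 0 d)(a′ b′; 0 d′)⁻¹ ∈ Γ¹` forces
`(a, b, d) = (a′, b′, d′)` (the tree's uniqueness of the Hermite normal form). [cite: AndrianovZhuravlev2015, Ch. 1 §3.2 Proposition 3.7 (uniqueness) (p0033)] [cite: Eie2008, §3.3] -/
theorem repElem_inj_of_mem (hp : 0 < p) {M₁ : posSimilitudeGroup 1} (hM₁ : M₁ ∈ (heckeReps p).image repElem)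
    {M₂ : posSimilitudeGroup 1} (hM₂ : M₂ ∈ (heckeReps p).image repElem)
    (h : M₁ * M₂⁻¹ ∈ levelPos (⊤ : Subgroup (Matrix.symplecticGroup (Fin 1) ℤ))) : M₁ = M₂ := by
  obtain ⟨i, hi, rfl⟩ := Finset.mem_image.1 hM₁
  obtain ⟨j, hj, rfl⟩ := Finset.mem_image.1 hM₂
  obtain ⟨γ₀, hγ₀⟩ := mem_levelPos_top_iff.1 h
  have hmul : repElem i = ofFinTwo (γ₀ : Matrix (Fin 2) (Fin 2) ℤ) (det_coe_SL_pos γ₀) * repElem j := by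
    rw [← hγ₀, inv_mul_cancel_right]
  rw [repElem_eq hp hi, repElem_eq hp hj, ← ofFinTwo_mul _ _ _ _ (by
    rw [Matrix.det_mul, γ₀.det_coe, one_mul, det_repMatrix_of_mem hp hj]; exact_mod_cast hp)] at hmul
  have h' := congrArg ratMat hmul
  rw [ratMat_ofFinTwo, ratMat_ofFinTwo] at h'
  have h'' := blockOfFinTwo_injective (Matrix.map_injective Int.cast_injective h')
  rw [eq_of_mul_repMatrix_eq hp hj hi γ₀ h''.symm]

end TElem

/-! ### §3 `(F|T(p))((τ)) = Σ_{(a b; 0 d)} d^{−k}F(((aτ + b)/d)) = F((pτ)) + p^{−k}Σ_{b<p}F(((τ + b)/p))` -/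

section Formula

variable {p : ℕ}

/-- **`(F|T(p))((τ)) = Σ_{(a,b,d) ∈ heckeReps p} d^{−k}·F(((aτ + b)/d))`** for a prime `p` and every `F` with `F|_{𝔥_1} ∈ 𝔐_φ(Γ¹)`
(A2-325's LEMMA 1.1 with the representatives of §2 and A2-326's evaluation of `F|_k(a b; 0 d)`).
[cite: AndrianovZhuravlev2015, Ch. 4 §1.1 (1.6) (p0237); Ch. 3 §1.1 (1.4) (p0096); Ch. 2 §3.2 (3.14) (p0069)] [cite: Eie2008, §3.3] -/
theorem heckeT_tElem_apply (hp : p.Prime) {F : Matrix (Fin 1) (Fin 1) ℂ → ℂ}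
    (hF : restrict F ∈ (slashRep k).fixedPoints (levelPos (⊤ : Subgroup (Matrix.symplecticGroup (Fin 1) ℤ)))) (τ : ℍ) :
    heckeT k ⊤ (tElem p hp.pos) (restrict F) ⟨one1 (τ : ℂ), one1_coe_mem τ⟩ =
      ∑ i ∈ heckeReps p, (((i.2.2 : ℤ) : ℂ) ^ k)⁻¹ * F (one1 ((((i.1 : ℤ) : ℂ) * τ + ((i.2.1 : ℤ) : ℂ)) / ((i.2.2 : ℤ) : ℂ))) := by
  classical
  rw [heckeT_apply_eq_sum ((heckeReps p).image repElem)
      (fun M hM => by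
        obtain ⟨i, hi, rfl⟩ := Finset.mem_image.1 hM
        exact repElem_mem_doubleCoset hp hi)
      (fun γ hγ => exists_repElem_cover hp.pos hγ) (fun M₁ hM₁ M₂ hM₂ h => repElem_inj_of_mem hp.pos hM₁ hM₂ h) hF,
    Finset.sum_apply, Finset.sum_image (repElem_injOn hp.pos)]
  refine Finset.sum_congr rfl fun i hi => ?_
  have hd : ((i.2.2 : ℤ) : ℂ) ≠ 0 := Int.cast_ne_zero.2 (mem_heckeReps' hp.pos hi).2.2.2.2.ne'
  rw [slashOn_restrict, restrict_apply, cmat_repElem hp.pos hi]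
  exact siegelSlash_triangular_apply F hd τ

/-- Sums over the Hermite representatives of a PRIME `p`: `Σ_{i ∈ heckeReps p} G(i) = G(p, 0, 1) + Σ_{b<p} G(1, b, p)`.
[cite: DiamondShurman2005, Prop. 5.2.1 (`β_∞` and the `β_j`)] [cite: Eie2008, §3.3] -/
theorem sum_heckeReps_prime {α : Type*} [AddCommMonoid α] (hp : p.Prime) (G : ℤ × ℤ × ℤ → α) :
    ∑ i ∈ heckeReps p, G i = G ((p : ℤ), 0, 1) + ∑ b ∈ Finset.range p, G (1, (b : ℤ), (p : ℤ)) := by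
  classical
  have hset : heckeReps p = insert ((p : ℤ), 0, 1) ((Finset.range p).image fun b : ℕ => ((1 : ℤ), (b : ℤ), (p : ℤ))) := by
    ext i
    rw [mem_heckeReps_prime_iff hp, Finset.mem_insert, Finset.mem_image]
    constructor
    · rintro (⟨h1, hb, hbp, h4⟩ | h)
      · right
        obtain ⟨a, b, d⟩ := i
        simp only at h1 hb hbp h4
        subst h1 h4
        refine ⟨b.toNat, Finset.mem_range.2 (by omega), ?_⟩
        rw [Int.toNat_of_nonneg hb]
      · exact Or.inl h
    · rintro (h | ⟨b, hb, rfl⟩)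
      · exact Or.inr h
      · exact Or.inl ⟨rfl, by dsimp only; positivity, by dsimp only; exact_mod_cast Finset.mem_range.1 hb, rfl⟩
  have hnot : ((p : ℤ), (0 : ℤ), (1 : ℤ)) ∉ (Finset.range p).image fun b : ℕ => ((1 : ℤ), (b : ℤ), (p : ℤ)) := by
    intro h
    obtain ⟨b, -, hb⟩ := Finset.mem_image.1 h
    have h1 := congrArg Prod.fst hb
    simp only at h1
    exact hp.one_lt.ne' (by exact_mod_cast h1.symm)
  rw [hset, Finset.sum_insert hnot, Finset.sum_image fun b₁ _ b₂ _ h => by simpa using h]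

/-- **The explicit formula: `(F|T(p))((τ)) = F((pτ)) + p^{−k}Σ_{b=0}^{p−1}F(((τ + b)/p))`** (A–Z's normalisation (3.14), no power of
`det`). [cite: AndrianovZhuravlev2015, Ch. 4 §1.1 (1.6) (p0237); Ch. 2 §3.2 (3.14) (p0069)] [cite: DiamondShurman2005, Prop. 5.2.1] -/
theorem heckeT_tElem_apply_explicit (hp : p.Prime) {F : Matrix (Fin 1) (Fin 1) ℂ → ℂ}
    (hF : restrict F ∈ (slashRep k).fixedPoints (levelPos (⊤ : Subgroup (Matrix.symplecticGroup (Fin 1) ℤ)))) (τ : ℍ) :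
    heckeT k ⊤ (tElem p hp.pos) (restrict F) ⟨one1 (τ : ℂ), one1_coe_mem τ⟩ =
      F (one1 ((p : ℂ) * τ)) + ((p : ℂ) ^ k)⁻¹ * ∑ b ∈ Finset.range p, F (one1 (((τ : ℂ) + b) / p)) := by
  rw [heckeT_tElem_apply hp hF, sum_heckeReps_prime hp, Finset.mul_sum]
  congr 1
  · simp
  · refine Finset.sum_congr rfl fun b _ => ?_
    simp

end Formula

/-! ### §4 The junction with Eie's level-one `T(p)`: `F|T(p) = p^{1−k}·T(p)f` -/

section Eie

variable {p : ℕ}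

/-- A level-one `ModularForm 𝒮ℒ k`, read on `𝔥_1` by p16's `ofUHPFun`, restricts into `𝔐_φ(Γ¹)` (A2-325 (1.5) with the tree's
`𝔐_k(Γ¹, 1) = M_1^k` dictionary). [cite: AndrianovZhuravlev2015, Ch. 4 §1.1 (1.5) (p0237); Ch. 2 §2.2 («𝔐_kⁿ = 𝔐_k(Γⁿ, 1)») (p0064)] [cite: Klingen1990, §4 Definition (p. 43)] -/
theorem restrict_ofUHPFun_mem_fixedPoints {F : Type*} [FunLike F ℍ ℂ] [ModularFormClass F 𝒮ℒ k] (f : F) :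
    restrict (ofUHPFun f) ∈ (slashRep k).fixedPoints (levelPos (⊤ : Subgroup (Matrix.symplecticGroup (Fin 1) ℤ))) :=
  (isSiegelModularFormLevel_top_one_iff.2 (isSiegelModularForm_ofUHPFun f)).restrict_mem_fixedPoints

/-- **A–Z's `T(p)` on `Γ¹ = Sp₂(ℤ)` IS Eie's level-one `T(p)` up to `p^{k−1}`**: for `f ∈ M_k(SL₂(ℤ))` (Mathlib) and `p` prime,
`(ofUHPFun f|T(p))((τ)) = p^{1−k}·(T(p)f)(τ)` with the tree's `Literature.NumberTheory.ModularForms.heckeT` («`T(n)(f(z)) = n^{k−1}Σ_{ad=n}Σ_{b=0}^{d−1}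
d^{−k}f((az+b)/d)`»). [cite: Eie2008, §3.3 (definition of `T(n)`)] [cite: AndrianovZhuravlev2015, Ch. 4 §1.1 (1.6) (p0237); Ch. 3 §3.2 (3.12) (p0134)] -/
theorem heckeT_tElem_ofUHPFun (hp : p.Prime) (f : ModularForm 𝒮ℒ k) (τ : ℍ) :
    heckeT k ⊤ (tElem p hp.pos) (restrict (ofUHPFun f)) ⟨one1 (τ : ℂ), one1_coe_mem τ⟩ =
      (p : ℂ) ^ (1 - k) * Literature.NumberTheory.ModularForms.heckeT hp.pos f τ := by
  have hp0 : (p : ℂ) ≠ 0 := Nat.cast_ne_zero.2 hp.ne_zero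
  rw [heckeT_tElem_apply hp (restrict_ofUHPFun_mem_fixedPoints f), ModularForms.heckeT_apply, ← mul_assoc, ← zpow_add₀ hp0,
    show (1 - k) + (k - 1) = 0 by ring, zpow_zero, one_mul]
  refine Finset.sum_congr rfl fun i _ => ?_
  simp only [_root_.zpow_neg, ofUHPFun, Function.comp_apply, one1_apply]

end Eie

end SiegelHecke

end Literature.NumberTheory.ModularForms
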